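import Literature.AlgebraicGeometry.Frobenioids.ElementaryFrobenioidMap
import Literature.AlgebraicGeometry.Frobenioids.Frobenioid
import Literature.AlgebraicGeometry.Frobenioids.MonoidTransport
import HarnessLib

/-!
# Frobenioids I, Definition 1.3 is invariant under an isomorphism `θ : Φ ≅ Φ'` of the divisor monoid on `D`

Mochizuki, *The geometry of Frobenioids I: the general theory*, Kyushu J. Math. **62** (2008) 293–400,
Definition 1.1 (iii), kurims text p. 20 ("the assignment `Φ ↦ F_Φ` is functorial with respect to
homomorphisms of functors valued in monoids `Φ → Φ'`") and Definitions 1.2, 1.3, pp. 21–25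
[cite: MochizukiFrdI2008, Def. 1.3]. The paper identifies a divisor monoid with any isomorphic one
tacitly (e.g. `Φ ⥲ d · Φ` in Def. 2.4 (iii) / Prop. 2.5 (iii), p. 48–49); this PROOF-ONLY file supplies
the corresponding kernel transport, GAP-LEDGER row G-L6t9-1 part (T3) of the abc-iut cell (seat
abc-iut-w4-d018; part (T2), invariance under a natural isomorphism of the structure functor, and the glue
for sub-DAG row P25-L09 are abc-iut-L6-t9's).

For a pre-Frobenioid `F : C → F_Φ` and an isomorphism `θ : Φ ≅ Φ'` of monoids on `D`, put
`F' := F ⋙ ElemFrobenioid.map θ.hom : C → F_{Φ'}` (same category `C`, same base category `D`, same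
projection `C → D`, same `Base(φ)` and `deg_Fr(φ)`, and `Div_{F'}(φ) = θ(Div_F(φ))`). Then:
* the dictionary: every notion of Def. 1.2 for `F'` is the same notion for `F` — literally (`Iff.rfl`) for
  the `Base`/`deg_Fr`-notions (linear, base-isomorphism, pre-step, pull-back morphism, base-identity,
  `O^▷`, `O^×`, …) and through the injectivity of `θ` for the `Div`-notions (isometry, metric equivalence,
  co-angular, LB-invertible, Frobenius type, Frobenius-trivial, isotropic, isotropic hull, `invDiv`);
* `IsMonoidOn.of_iso`, `IsPreFrobenioid.comp_map_of_iso` — `Φ'` is a (divisorial) monoid on `D` and `F'` a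
  pre-Frobenioid;
* **`PreFrobenioid.IsFrobenioid.comp_map_of_iso`** — `F'` is a Frobenioid if `F` is (clause by clause);
* `cdToElem_comp_map_imageMonoidι` — Prop. 2.5 (iii)(b)'s "`F_{d·Φ} = (F_Φ)(d) ⊆ F_Φ`": `cdToElem F δ ⋙ F_ι` IS
  `C(d) ⊆ C → F_Φ` (`rfl`), the bridge abc-iut-L6-t9's glue composes with.

PROOF-ONLY: no definition, no new named fact; [folklore] bookkeeping over the tree's typed Def. 1.1–1.3.
-/

noncomputable section

namespace Literature.AlgebraicGeometry.Frobenioids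

open CategoryTheory Opposite

universe w v v' u u'

variable {D : Type u} [Category.{v} D] {Φ Φ' : Dᵒᵖ ⥤ CommMonCat.{w}}

/-! ### An isomorphism of monoids on `D`: objectwise injectivity, divisibility, the monoid axioms -/

/-- The components of an isomorphism `θ : Φ ≅ Φ'` of monoids on `D` are injective (the tacit identification of
isomorphic divisor monoids, FrdI Def. 1.1 (iii)). [cite: MochizukiFrdI2008, Def. 1.1(iii) p.20] -/
theorem iso_hom_app_injective (θ : Φ ≅ Φ') (A : Dᵒᵖ) : Function.Injective (θ.hom.app A).hom :=
  Function.LeftInverse.injective (g := (θ.inv.app A).hom)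
    (ElemFrobenioid.iso_inv_app_hom_app_apply θ A)

/-- The components of `θ.inv` are injective. [cite: MochizukiFrdI2008, Def. 1.1(iii) p.20] -/
theorem iso_inv_app_injective (θ : Φ ≅ Φ') (A : Dᵒᵖ) : Function.Injective (θ.inv.app A).hom :=
  Function.LeftInverse.injective (g := (θ.hom.app A).hom)
    (ElemFrobenioid.iso_hom_app_inv_app_apply θ A)

/-- Divisibility (the order `≤` of FrdI §0 on each `Φ(A)`) is invariant under the components of `θ`.
[cite: MochizukiFrdI2008, §0 p.12] -/
theorem iso_hom_app_dvd_iff (θ : Φ ≅ Φ') (A : Dᵒᵖ) (x y : Φ.obj A) :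
    (θ.hom.app A).hom x ∣ (θ.hom.app A).hom y ↔ x ∣ y := by
  refine ⟨fun h => ?_, fun h => map_dvd _ h⟩
  have h' := map_dvd (θ.inv.app A).hom h
  rwa [ElemFrobenioid.iso_inv_app_hom_app_apply, ElemFrobenioid.iso_inv_app_hom_app_apply] at h'

/-- Pull-backs of `Φ'` are the `θ`-conjugates of those of `Φ`: `f^*_{Φ'} = θ ∘ f^*_Φ ∘ θ⁻¹` (naturality of `θ`,
FrdI Def. 1.1 (ii)/(iii)). [cite: MochizukiFrdI2008, Def. 1.1(ii)] -/
theorem pull_eq_conj_of_iso (θ : Φ ≅ Φ') {A B : D} (f : B ⟶ A) (y : Φ'.obj (op A)) :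
    pull Φ' f y = (θ.hom.app (op B)).hom (pull Φ f ((θ.inv.app (op A)).hom y)) := by
  rw [hom_app_pull, ElemFrobenioid.iso_hom_app_inv_app_apply]

/-- **A monoid on `D` stays a monoid on `D` along an isomorphism** `θ : Φ ≅ Φ'` (FrdI Def. 1.1 (ii):
characteristic injectivity of the pull-backs and bijectivity along FSM-morphisms), granted that `Φ` is
divisorial (so that `Φ'` is sharp and characteristic injectivity reduces to injectivity).
[cite: MochizukiFrdI2008, Def. 1.1(ii)] -/
theorem IsMonoidOn.of_iso (θ : Φ ≅ Φ') (hΦ : IsMonoidOn Φ)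
    (hΦd : Objectwise (fun M _ => IsDivisorial M) Φ) : IsMonoidOn Φ' := by
  have hinj : ∀ {A B : D} (f : B ⟶ A), Function.Injective (pull Φ' f) := by
    intro A B f y y' h
    rw [pull_eq_conj_of_iso θ, pull_eq_conj_of_iso θ] at h
    have h1 := (hΦ.isCharInjective f).1 (iso_hom_app_injective θ _ h)
    exact iso_inv_app_injective θ _ h1
  have hdiv : ∀ B : D, IsDivisorial (Φ'.obj (op B)) := fun B =>
    IsDivisorial.of_mulEquiv (θ.app (op B)).commMonCatIsoToMulEquiv (hΦd B)
  refine ⟨fun {A B} f => ⟨hinj f, ?_⟩, fun {A B} f hf => ⟨hinj f, fun z => ?_⟩⟩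
  · exact associatesMap_injective_of_isSharp (hdiv B).isSharp (hinj f)
  · obtain ⟨a, ha⟩ := (hΦ.bijective_of_isFSM f hf).2 ((θ.inv.app (op B)).hom z)
    refine ⟨(θ.hom.app (op A)).hom a, ?_⟩
    rw [pull_eq_conj_of_iso θ, ElemFrobenioid.iso_inv_app_hom_app_apply, ha,
      ElemFrobenioid.iso_hom_app_inv_app_apply]

/-- Divisoriality of a monoid on `D` (FrdI Def. 1.1 (i)/(ii), objectwise) is invariant under isomorphism
(objectwise `MonoidTransport`). [cite: MochizukiFrdI2008, Def. 1.1(ii)] -/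
theorem objectwise_isDivisorial_of_iso (θ : Φ ≅ Φ') (hΦd : Objectwise (fun M _ => IsDivisorial M) Φ) :
    Objectwise (fun M _ => IsDivisorial M) Φ' := fun B =>
  IsDivisorial.of_mulEquiv (θ.app (op B)).commMonCatIsoToMulEquiv (hΦd B)

namespace PreFrobenioid

variable {C : Type u'} [Category.{v'} C] {F : C ⥤ ElemFrobenioid Φ}

/-! ### The dictionary for `F' := F ⋙ F_κ`: the `Base`/`deg_Fr`-notions are literally unchanged -/

section AnyHom

variable (κ : Φ ⟶ Φ')

/-- Same base objects. [cite: MochizukiFrdI2008, Def. 1.1(iii) p.20] -/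
theorem baseObj_comp_map (A : C) : baseObj (F ⋙ ElemFrobenioid.map κ) A = baseObj F A := rfl

/-- Same projection functor `C → D`. [cite: MochizukiFrdI2008, Def. 1.1(iii) p.20] -/
theorem baseFunctor_comp_map : baseFunctor (F ⋙ ElemFrobenioid.map κ) = baseFunctor F := rfl

/-- Same `Base(φ)`. [cite: MochizukiFrdI2008, Def. 1.1(iii) p.20] -/
theorem base_comp_map {A B : C} (φ : A ⟶ B) : Base (F ⋙ ElemFrobenioid.map κ) φ = Base F φ := rfl

/-- `Div_{F'}(φ) = κ(Div_F(φ))`. [cite: MochizukiFrdI2008, Def. 1.1(iii) p.20] -/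
theorem div_comp_map {A B : C} (φ : A ⟶ B) :
    Div (F ⋙ ElemFrobenioid.map κ) φ = (κ.app (op (baseObj F A))).hom (Div F φ) := rfl

/-- Same `deg_Fr(φ)`. [cite: MochizukiFrdI2008, Def. 1.1(iii) p.20] -/
theorem degFr_comp_map {A B : C} (φ : A ⟶ B) : degFr (F ⋙ ElemFrobenioid.map κ) φ = degFr F φ := rfl

/-- Linear morphisms are the same. [cite: MochizukiFrdI2008, Def. 1.2(i)] -/
theorem isLinear_comp_map_iff {A B : C} (φ : A ⟶ B) :
    IsLinear (F ⋙ ElemFrobenioid.map κ) φ ↔ IsLinear F φ := Iff.rfl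

/-- Base-isomorphisms are the same. [cite: MochizukiFrdI2008, Def. 1.2(i)] -/
theorem isBaseIso_comp_map_iff {A B : C} (φ : A ⟶ B) :
    IsBaseIso (F ⋙ ElemFrobenioid.map κ) φ ↔ IsBaseIso F φ := Iff.rfl

/-- Pre-steps are the same. [cite: MochizukiFrdI2008, Def. 1.2(iii)] -/
theorem isPreStep_comp_map_iff {A B : C} (φ : A ⟶ B) :
    IsPreStep (F ⋙ ElemFrobenioid.map κ) φ ↔ IsPreStep F φ := Iff.rfl

/-- Base-equivalence is the same. [cite: MochizukiFrdI2008, Def. 1.2(ii)] -/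
theorem baseEquivalent_comp_map_iff {A B : C} (φ ψ : A ⟶ B) :
    BaseEquivalent (F ⋙ ElemFrobenioid.map κ) φ ψ ↔ BaseEquivalent F φ ψ := Iff.rfl

/-- Base-identity endomorphisms are the same. [cite: MochizukiFrdI2008, Def. 1.2(ii)] -/
theorem isBaseIdentity_comp_map_iff {A : C} (φ : A ⟶ A) :
    IsBaseIdentity (F ⋙ ElemFrobenioid.map κ) φ ↔ IsBaseIdentity F φ := Iff.rfl

/-- Pull-back morphisms are the same (the defining natural transformation only involves `Base`).
[cite: MochizukiFrdI2008, Def. 1.2(ii)] -/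
theorem isPullbackMorphism_comp_map_iff {A B : C} (φ : A ⟶ B) :
    IsPullbackMorphism (F ⋙ ElemFrobenioid.map κ) φ ↔ IsPullbackMorphism F φ := Iff.rfl

/-- `C^pl-bk` is the same. [cite: MochizukiFrdI2008, Def. 1.2(iv)] -/
theorem pullbackMorphisms_comp_map : pullbackMorphisms (F ⋙ ElemFrobenioid.map κ) = pullbackMorphisms F := rfl

/-- `O^▷(A)` is the same submonoid of `End_C(A)`. [cite: MochizukiFrdI2008, Def. 1.2(ii)] -/
theorem endSubmonoid_comp_map (A : C) : endSubmonoid (F ⋙ ElemFrobenioid.map κ) A = endSubmonoid F A := rfl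

/-- `O^×(A)` is the same subgroup of `Aut_C(A)`. [cite: MochizukiFrdI2008, Def. 1.2(ii)] -/
theorem unitsSubgroup_comp_map (A : C) : unitsSubgroup (F ⋙ ElemFrobenioid.map κ) A = unitsSubgroup F A := rfl

end AnyHom

/-! ### The dictionary for `F' := F ⋙ F_θ`, `θ` an isomorphism: the `Div`-notions -/

section IsoHom

variable (θ : Φ ≅ Φ')

/-- Isometries are the same (`θ` is injective). [cite: MochizukiFrdI2008, Def. 1.2(i)] -/
theorem isIsometry_comp_map_iff {A B : C} (φ : A ⟶ B) :
    IsIsometry (F ⋙ ElemFrobenioid.map θ.hom) φ ↔ IsIsometry F φ :=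
  map_eq_one_iff _ (iso_hom_app_injective θ _)

/-- Metric equivalence is the same. [cite: MochizukiFrdI2008, Def. 1.2(i)] -/
theorem metricallyEquivalent_comp_map_iff {A B : C} (φ ψ : A ⟶ B) :
    MetricallyEquivalent (F ⋙ ElemFrobenioid.map θ.hom) φ ψ ↔ MetricallyEquivalent F φ ψ :=
  (iso_hom_app_injective θ _).eq_iff

/-- Co-angular morphisms are the same. [cite: MochizukiFrdI2008, Def. 1.2(iii)] -/
theorem isCoAngular_comp_map_iff {A B : C} (φ : A ⟶ B) :
    IsCoAngular (F ⋙ ElemFrobenioid.map θ.hom) φ ↔ IsCoAngular F φ :=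
  ⟨fun h _ _ γ β α hc hl hi hp hb => h γ β α hc hl ((isIsometry_comp_map_iff θ β).mpr hi) hp hb,
    fun h _ _ γ β α hc hl hi hp hb => h γ β α hc hl ((isIsometry_comp_map_iff θ β).mp hi) hp hb⟩

/-- Co-angular pre-steps are the same. [cite: MochizukiFrdI2008, Def. 1.3(iii)] -/
theorem isCoAngularPreStep_comp_map_iff {A B : C} (φ : A ⟶ B) :
    IsCoAngularPreStep (F ⋙ ElemFrobenioid.map θ.hom) φ ↔ IsCoAngularPreStep F φ :=
  and_congr (isCoAngular_comp_map_iff θ φ) Iff.rfl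

/-- LB-invertible morphisms are the same. [cite: MochizukiFrdI2008, Def. 1.2(iii)] -/
theorem isLBInvertible_comp_map_iff {A B : C} (φ : A ⟶ B) :
    IsLBInvertible (F ⋙ ElemFrobenioid.map θ.hom) φ ↔ IsLBInvertible F φ :=
  and_congr (isCoAngular_comp_map_iff θ φ) (isIsometry_comp_map_iff θ φ)

/-- Morphisms of Frobenius type are the same. [cite: MochizukiFrdI2008, Def. 1.2(iii)] -/
theorem isFrobeniusType_comp_map_iff {A B : C} (φ : A ⟶ B) :
    IsFrobeniusType (F ⋙ ElemFrobenioid.map θ.hom) φ ↔ IsFrobeniusType F φ :=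
  and_congr (isLBInvertible_comp_map_iff θ φ) Iff.rfl

/-- Frobenius-trivial objects are the same. [cite: MochizukiFrdI2008, Def. 1.2(iv)] -/
theorem isFrobeniusTrivial_comp_map_iff (A : C) :
    IsFrobeniusTrivial (F ⋙ ElemFrobenioid.map θ.hom) A ↔ IsFrobeniusTrivial F A :=
  exists_congr fun _ => forall_congr' fun _ =>
    and_congr Iff.rfl (and_congr Iff.rfl (isFrobeniusType_comp_map_iff θ _))

/-- Isotropic objects are the same. [cite: MochizukiFrdI2008, Def. 1.2(iv)] -/
theorem isIsotropic_comp_map_iff (A : C) :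
    IsIsotropic (F ⋙ ElemFrobenioid.map θ.hom) A ↔ IsIsotropic F A :=
  ⟨fun h _ ψ hi hp => h ψ ((isIsometry_comp_map_iff θ ψ).mpr hi) hp,
    fun h _ ψ hi hp => h ψ ((isIsometry_comp_map_iff θ ψ).mp hi) hp⟩

/-- Isotropic hulls are the same. [cite: MochizukiFrdI2008, Def. 1.2(iv)] -/
theorem isIsotropicHull_comp_map_iff {A B : C} (φ : A ⟶ B) :
    IsIsotropicHull (F ⋙ ElemFrobenioid.map θ.hom) φ ↔ IsIsotropicHull F φ :=
  and_congr (isIsometry_comp_map_iff θ φ) <| and_congr Iff.rfl <|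
    and_congr (isIsotropic_comp_map_iff θ B) <|
      forall_congr' fun _ => forall_congr' fun _ => imp_congr (isIsotropic_comp_map_iff θ _) Iff.rfl

/-- `(ψ^*)⁻¹(Div ψ)` transforms by `θ`. [cite: MochizukiFrdI2008, Def. 1.3(iii)] -/
theorem invDiv_comp_map {B A : C} (ψ : B ⟶ A) (h : IsBaseIso F ψ) :
    invDiv (F ⋙ ElemFrobenioid.map θ.hom) ψ h = (θ.hom.app (op (baseObj F A))).hom (invDiv F ψ h) := by
  haveI : IsIso (Base F ψ) := h
  unfold invDiv
  exact (hom_app_pull θ.hom (inv (Base F ψ)) (Div F ψ)).symm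

end IsoHom

/-! ### Prop. 2.5 (iii)(b): `C(d) → F_{d·Φ} = (F_Φ)(d) ⊆ F_Φ` is `C(d) ⊆ C → F_Φ` -/

/-- **"the functors `C → F_Φ`, `C(d) → F_{d·Φ} = (F_Φ)(d) ⊆ F_Φ`"** (FrdI Prop. 2.5 (iii)(b), p. 49): the natural
functor `C(d) → F_{d·Φ}` (`cdToElem`, abc-iut-L6-t9 lineage) followed by the inclusion `F_{d·Φ} ⊆ F_Φ` — which is
`F_κ` for the inclusion `κ : d · Φ ⊆ Φ` of monoids on `D` (`imageMonoidι`) — IS the restriction of `C → F_Φ` to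
`C(d) ⊆ C`, definitionally. [cite: MochizukiFrdI2008, Prop. 2.5(iii) p.49] -/
theorem cdToElem_comp_map_imageMonoidι (F : C ⥤ ElemFrobenioid Φ) (δ : Φ ⟶ Φ) :
    cdToElem F δ ⋙ ElemFrobenioid.map (imageMonoidι δ) = wideSubcategoryInclusion (divIn F δ) ⋙ F := rfl

/-! ### The standing hypotheses: `F'` is a pre-Frobenioid -/

/-- **`F ⋙ F_θ` is a pre-Frobenioid if `F` is** (`Φ'` is a divisorial monoid on `D` by transport; the
connectivity / total epimorphicity of `D` and `C` are untouched). [cite: MochizukiFrdI2008, Def. 1.2] -/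
theorem _root_.Literature.AlgebraicGeometry.Frobenioids.IsPreFrobenioid.comp_map_of_iso (θ : Φ ≅ Φ')
    (h : IsPreFrobenioid Φ F) :
    IsPreFrobenioid Φ' (F ⋙ ElemFrobenioid.map θ.hom) where
  isMonoidOn := IsMonoidOn.of_iso θ h.isMonoidOn h.isDivisorial
  isDivisorial := objectwise_isDivisorial_of_iso θ h.isDivisorial
  isGraphConnected_base := h.isGraphConnected_base
  isTotallyEpimorphic_base := h.isTotallyEpimorphic_base
  isGraphConnected := h.isGraphConnected
  isTotallyEpimorphic := h.isTotallyEpimorphic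

/-! ### Definition 1.3 transported -/

/-- **FrdI Def. 1.3 is invariant under an isomorphism of the divisor monoid on `D`**: if `F : C → F_Φ` is a
Frobenioid and `θ : Φ ≅ Φ'`, then `F ⋙ F_θ : C → F_{Φ'}` is a Frobenioid. Every clause (i)–(vii) is the
same clause for `F` read through the dictionary above (same category, same base, same `Base`/`deg_Fr`;
`Div` moved by the injective `θ`). [cite: MochizukiFrdI2008, Def. 1.3] -/
theorem IsFrobenioid.comp_map_of_iso (θ : Φ ≅ Φ') (hF : IsFrobenioid F) :
    IsFrobenioid (F ⋙ ElemFrobenioid.map θ.hom) := by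
  have hiso := fun {X Y : C} (γ : X ⟶ Y) => isIsometry_comp_map_iff (F := F) θ γ
  have hme := fun {X Y : C} (γ γ' : X ⟶ Y) => metricallyEquivalent_comp_map_iff (F := F) θ γ γ'
  have hco := fun {X Y : C} (γ : X ⟶ Y) => isCoAngular_comp_map_iff (F := F) θ γ
  have hcps := fun {X Y : C} (γ : X ⟶ Y) => isCoAngularPreStep_comp_map_iff (F := F) θ γ
  have hlb := fun {X Y : C} (γ : X ⟶ Y) => isLBInvertible_comp_map_iff (F := F) θ γ
  have hft := fun {X Y : C} (γ : X ⟶ Y) => isFrobeniusType_comp_map_iff (F := F) θ γ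
  exact {
    isPreFrobenioid := hF.isPreFrobenioid.comp_map_of_iso θ
    i_a := fun A₀ => by
      obtain ⟨A, hA, hi⟩ := hF.i_a A₀
      exact ⟨A, (isFrobeniusTrivial_comp_map_iff θ A).mpr hA, hi⟩
    i_b := hF.i_b
    i_c := hF.i_c
    ii_exists := fun A n => by
      obtain ⟨B, φ, hφ, hd⟩ := hF.ii_exists A n
      exact ⟨B, φ, (hft φ).mpr hφ, hd⟩
    ii_unique := fun A B B' φ ψ hφ hψ hd => hF.ii_unique φ ψ ((hft φ).mp hφ) ((hft ψ).mp hψ) hd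
    iii_a := fun X Y Z f g hf hg => (hco _).mpr (hF.iii_a f g ((hco f).mp hf) ((hco g).mp hg))
    iii_b := fun A' A φ hφ ψ => (hco ψ).mpr (hF.iii_b φ ((hcps φ).mp hφ) ψ)
    iii_c := fun A B φ hφ => hF.iii_c φ ((hcps φ).mp hφ)
    iii_c_base := fun A B φ φ' hφ hφ' hb => hF.iii_c_base φ φ' ((hcps φ).mp hφ) ((hcps φ').mp hφ') hb
    iii_d_under_full := fun A B B' φ φ' hφ hφ' hdvd => by
      obtain ⟨f, hf, hcomp⟩ := hF.iii_d_under_full φ φ' ((hcps φ).mp hφ) ((hcps φ').mp hφ')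
        ((iso_hom_app_dvd_iff θ _ _ _).mp hdvd)
      exact ⟨f, (hcps f).mpr hf, hcomp⟩
    iii_d_under_surj := fun A x => by
      obtain ⟨B, φ, hφ, hx⟩ := hF.iii_d_under_surj A ((θ.inv.app (op (baseObj F A))).hom x)
      refine ⟨B, φ, (hcps φ).mpr hφ, ?_⟩
      rw [div_comp_map, hx, ElemFrobenioid.iso_hom_app_inv_app_apply]
    iii_d_over_full := fun A B B' ψ ψ' h h' hdvd => by
      have hdvd' : invDiv F ψ' ((hcps ψ').mp h').2.2 ∣ invDiv F ψ ((hcps ψ).mp h).2.2 := by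
        rw [invDiv_comp_map θ, invDiv_comp_map θ] at hdvd
        exact (iso_hom_app_dvd_iff θ _ _ _).mp hdvd
      obtain ⟨g, hg, hcomp⟩ := hF.iii_d_over_full ψ ψ' ((hcps ψ).mp h) ((hcps ψ').mp h') hdvd'
      exact ⟨g, (hcps g).mpr hg, hcomp⟩
    iii_d_over_surj := fun A x => by
      obtain ⟨B, ψ, h, hx⟩ := hF.iii_d_over_surj A ((θ.inv.app (op (baseObj F A))).hom x)
      refine ⟨B, ψ, (hcps ψ).mpr h, ?_⟩
      rw [invDiv_comp_map θ]
      exact (congrArg _ hx).trans (ElemFrobenioid.iso_hom_app_inv_app_apply θ _ x)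
    iv_a_exists := fun A B φ => by
      obtain ⟨X, Y, γ, β, α, hcomp, hγ, hβ, hα⟩ := hF.iv_a_exists φ
      exact ⟨X, Y, γ, β, α, hcomp, (hft γ).mpr hγ, hβ, hα⟩
    iv_a_unique := fun A B X Y X' Y' φ γ β α γ' β' α' h1 hγ hβ hα h2 hγ' hβ' hα' =>
      hF.iv_a_unique φ γ β α γ' β' α' h1 ((hft γ).mp hγ) hβ hα h2 ((hft γ').mp hγ') hβ' hα'
    iv_b := fun A B φ hφ => ⟨(hlb φ).mpr (hF.iv_b φ hφ).1, (hF.iv_b φ hφ).2⟩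
    v_a := hF.v_a
    v_b_exists := fun A B φ hφ => by
      obtain ⟨X, β, α, hcomp, hβ, hα1, hα2⟩ := hF.v_b_exists φ hφ
      exact ⟨X, β, α, hcomp, (hcps β).mpr hβ, (hiso α).mpr hα1, hα2⟩
    v_b_unique := fun A B X X' φ β α β' α' h1 hβ hα h2 hβ' hα' =>
      hF.v_b_unique φ β α β' α' h1 ((hcps β).mp hβ) ⟨(hiso α).mp hα.1, hα.2⟩ h2 ((hcps β').mp hβ')
        ⟨(hiso α').mp hα'.1, hα'.2⟩
    v_c_exists := fun A B φ hφ => by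
      obtain ⟨X, β', α', hcomp, ⟨hβ1, hβ2⟩, hα'⟩ := hF.v_c_exists φ hφ
      exact ⟨X, β', α', hcomp, ⟨(hiso β').mpr hβ1, hβ2⟩, (hcps α').mpr hα'⟩
    v_c_unique := fun A B X X' φ β α β' α' h1 hβ hα h2 hβ' hα' =>
      hF.v_c_unique φ β α β' α' h1 ⟨(hiso β).mp hβ.1, hβ.2⟩ ((hcps α).mp hα) h2
        ⟨(hiso β').mp hβ'.1, hβ'.2⟩ ((hcps α').mp hα')
    vi := fun A B φ ψ hφ hψ hb hm =>
      hF.vi φ ψ ((hcps φ).mp hφ) ((hcps ψ).mp hψ) hb ((hme φ ψ).mp hm)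
    vii_a := fun A => by
      obtain ⟨B, φ, h⟩ := hF.vii_a A
      exact ⟨B, φ, (isIsotropicHull_comp_map_iff θ φ).mpr h⟩
    vii_b := fun A B φ hA =>
      (isIsotropic_comp_map_iff θ B).mpr (hF.vii_b φ ((isIsotropic_comp_map_iff θ A).mp hA)) }

/-- The same along `θ.inv`: `F ⋙ F_{θ⁻¹}` is a Frobenioid if `F : C → F_{Φ'}` is. [cite: MochizukiFrdI2008, Def. 1.3] -/
theorem IsFrobenioid.comp_map_of_iso_inv (θ : Φ ≅ Φ') {F : C ⥤ ElemFrobenioid Φ'} (hF : IsFrobenioid F) :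
    IsFrobenioid (F ⋙ ElemFrobenioid.map θ.inv) :=
  hF.comp_map_of_iso θ.symm

/-- Conversely, `F` is a Frobenioid if `F ⋙ F_θ` is (apply the transport along `θ⁻¹` and
`map θ.hom ⋙ map θ.inv = 𝟭`). [cite: MochizukiFrdI2008, Def. 1.3] -/
theorem IsFrobenioid.of_comp_map_of_iso (θ : Φ ≅ Φ')
    (h : IsFrobenioid (F ⋙ ElemFrobenioid.map θ.hom)) : IsFrobenioid F := by
  have h' := h.comp_map_of_iso θ.symm
  rwa [Functor.assoc, Iso.symm_hom, ElemFrobenioid.map_hom_comp_map_inv, Functor.comp_id] at h'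

/-- Hence: `F ⋙ F_θ` is a Frobenioid iff `F` is. [cite: MochizukiFrdI2008, Def. 1.3] -/
theorem isFrobenioid_comp_map_iff (θ : Φ ≅ Φ') :
    IsFrobenioid (F ⋙ ElemFrobenioid.map θ.hom) ↔ IsFrobenioid F :=
  ⟨IsFrobenioid.of_comp_map_of_iso θ, IsFrobenioid.comp_map_of_iso θ⟩

end PreFrobenioid

end Literature.AlgebraicGeometry.Frobenioids

end
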